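import Literature.Analysis.FluidPDE.FluidComputer.ThresholdLevelTableA5
import HarnessLib

/-!
# Kernel run of the A = 5 level-table checker, chunks 32 … 35 (steps 800 … 899) (bp3 gen 13, layer 4)

HONEST FRAMING: low prior, high value-of-information experiment on Tao's machine paradigm; NOT a
claim that NS blows up.

Four kernel evaluations (`decide +kernel`; no `native_decide`, no extra axioms) of the checker
`runSteps` (`ThresholdLevelCheck.lean`) on 25 steps of `ThresholdLevelTableA5.stepsT` at a time, from
the entry box `Bc i` towards the next chunk's first level, returning the entry box `Bc (i+1)`
(≈ 30 s of kernel time per chunk; same scheme as `ThresholdLevelTableRun0 … 7` for A = 2).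
-/

namespace Literature.Analysis.FluidPDE.FluidComputer

namespace ThresholdLevelTableA5

set_option maxHeartbeats 10000000 in
set_option maxRecDepth 200000 in
/-- Chunk 32 of the A = 5 table run (steps 800 … 824). [folklore] -/
theorem run32 : runSteps 60 12 3 GIt RbIt Bc32 chunk32 3721322251574016 = some Bc33 := by
  decide +kernel

set_option maxHeartbeats 10000000 in
set_option maxRecDepth 200000 in
/-- Chunk 33 of the A = 5 table run (steps 825 … 849). [folklore] -/
theorem run33 : runSteps 60 12 3 GIt RbIt Bc33 chunk33 4073486432187441 = some Bc34 := by
  decide +kernel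

set_option maxHeartbeats 10000000 in
set_option maxRecDepth 200000 in
/-- Chunk 34 of the A = 5 table run (steps 850 … 874). [folklore] -/
theorem run34 : runSteps 60 12 3 GIt RbIt Bc34 chunk34 4458977371872769 = some Bc35 := by
  decide +kernel

set_option maxHeartbeats 10000000 in
set_option maxRecDepth 200000 in
/-- Chunk 35 of the A = 5 table run (steps 875 … 899). [folklore] -/
theorem run35 : runSteps 60 12 3 GIt RbIt Bc35 chunk35 4880948920258608 = some Bc36 := by
  decide +kernel

end ThresholdLevelTableA5

end Literature.Analysis.FluidPDE.FluidComputer
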